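import Literature.NumberTheory.Sieve.Maynard2016Lemma93LocalFactors
import Literature.NumberTheory.Sieve.FGKMT2018MainTermRegroup
import HarnessLib

/-!
# Maynard 2016, proof of Lemma 9.3 — the size-free admissible box (displays (9.26)–(9.27))

Sources: J. Maynard, *Dense clusters of primes in subsets*, Compositio Math. 152 (2016) 1517–1554 =
arXiv:1405.2593 [Maynard2016DenseClusters], proof of Lemma 9.3, pp. 23–24 (displays (9.25)–(9.27));
K. Ford, B. Green, S. Konyagin, J. Maynard, T. Tao, *Long gaps between primes*, JAMS 31 (2018)
[FordGreenKonyaginMaynardTao2018], §7 (7.5) and Theorem 6 (7.13).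

After (9.25) (`FGKMT2018.yVarM_eq_sum_yVar_quot`), `y^{(m)}_r` is a sum over `e ∈ 𝒟_k(𝓛)` with `r ∣ e`.
In the tree `𝒟_k(𝓛) = dkBox L B R` bounds EVERY coordinate by `⌊R⌋`, whereas Maynard's evaluation of the
`(s,t)`-sum as an Euler product over the primes (display (9.27), «by multiplicativity we can rewrite as a
product») needs a summation range defined by LOCAL (prime-by-prime) conditions only. This file supplies that
range and shows the passage is exact:

* `admBoxN L B N` — vectors `d` with every `dᵢ ∣ N`, `∏ dᵢ` square-free and `WB`-coprime, index-admissible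
  (NO size condition; `N` is the induction parameter of the Euler product: `mem_admBoxN_of_mem_mul_of_not_dvd`,
  `admBoxN_subset_mul`, `update_mul_mem_admBoxN`, `update_div_mem_admBoxN`, `mem_admBoxN_of_dvd`), and
  `admBox L B R = admBoxN L B (⌊R⌋#)` (all primes `≤ ⌊R⌋`, the primes occurring in `𝒟_k(𝓛)`); `dkBox ⊆ admBox`
  and `dkBox = admBox ∩ {∀ i, eᵢ ≤ ⌊R⌋}` (`dkBox_subset_admBox`, `dkBox_eq_filter_admBox`);
* the vectors of `admBox ∖ dkBox` have `∏ eᵢ > ⌊R⌋`, hence `y_e = 0` (`y` is supported on the simplex: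
  `FGKMT2018.yVar_eq_zero_of_floor_lt`) — `yVar_eq_zero_of_mem_admBox_of_not_mem`, and every `y`-weighted sum
  over `dkBox` equals the same sum over `admBox` (`sum_filter_admBox_eq_sum_filter_dkBox`); in particular (9.25)
  reads `y^{(m)}_r = (r/φ_L(r)) ∑_{e ∈ admBox, r ∣ e} y_e σ(r,e)/φ_ω(∏ eᵢ/rᵢ)` (`yVarM_eq_sum_admBox`);
* the local structure used by the Euler product: closure under coordinatewise divisors
  (`mem_admBox_of_dvd`, `update_div_mem_admBox`) and under inserting a new prime `p ≤ ⌊R⌋`, `p ∤ WB·∏eᵢ`,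
  at an admissible index (`update_mul_mem_admBox` — the twin of `FGKMT2018.update_mul_mem_dkBox` without the
  size hypothesis);
* the Euler-product step (display (9.27), «by multiplicativity»): over `qBox L B N m M` (`q ∈ admBoxN N`,
  `q_m = 1`, `(∏ qᵢ, M) = 1`) a weight with `w(q·p@j) = w(q)·w_p(j)` satisfies, for a prime `p ∤ N`,
  `∑_{qBox(N·p)} w = (∑_{qBox(N)} w)·(1 + [p ∤ WB·M] ∑_{j ∈ admIdx(p)∖{m}} w_p(j))` (`sum_qBox_mul_prime`) —
  iterating over the primes of a square-free modulus gives the finite Euler product of the `(s,t)`-sum.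

## References
* J. Maynard, *Dense clusters of primes in subsets*, Compositio Math. 152 (2016), proof of Lemma 9.3
  pp. 23–24, (9.25)–(9.27) [Maynard2016DenseClusters].
* K. Ford, B. Green, S. Konyagin, J. Maynard, T. Tao, *Long gaps between primes*, JAMS 31 (2018), §7 (7.5),
  Thm 6 (7.13) [FordGreenKonyaginMaynardTao2018].
-/

noncomputable section

open Finset
open scoped Nat

namespace Literature.NumberTheory.Sieve

namespace FGKMT2018

variable {k : ℕ}

/-- The admissible box with prime support in a modulus `N`: `d : Fin k → ℕ` with every `dᵢ ∣ N`,
`∏ dᵢ` square-free and coprime to `WB`, and every prime of `d_j` admissible at index `j`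
(the conditions of `𝒟_k(𝓛)` with the coordinate bound `dᵢ ≤ R` replaced by `dᵢ ∣ N`; the parameter `N`
is what one inducts on to evaluate multiplicative sums as Euler products).
[cite: Maynard2016DenseClusters, proof of Lemma 9.3 p. 24, (9.27) (the starred sum over s, t)] -/
def admBoxN (L : Fin k → ℤ × ℤ) (B N : ℕ) : Finset (Fin k → ℕ) :=
  (Fintype.piFinset fun _ : Fin k => N.divisors).filter fun d =>
    Squarefree (∏ i, d i) ∧ Nat.Coprime (∏ i, d i) (wCut k B * B) ∧
      ∀ j : Fin k, ∀ p ∈ (d j).primeFactors,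
        ∃ n ∈ Finset.range p, (p : ℤ) ∣ formEval (L j) n ∧
          ∀ j' : Fin k, j' < j → ¬ (p : ℤ) ∣ formEval (L j') n

/-- The size-free admissible box of Lemma 9.3: `admBoxN` for the primorial `N = ⌊R⌋#` (all primes `≤ ⌊R⌋`,
the primes that occur in `𝒟_k(𝓛) = dkBox L B R`).
[cite: Maynard2016DenseClusters, proof of Lemma 9.3 p. 24, (9.27)] -/
def admBox (L : Fin k → ℤ × ℤ) (B : ℕ) (R : ℝ) : Finset (Fin k → ℕ) :=
  admBoxN L B (primorial ⌊R⌋₊)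

/-- `admBox = admBoxN (⌊R⌋#)` (definitional). [cite: Maynard2016DenseClusters, proof of Lemma 9.3 p. 24] -/
theorem admBox_eq (L : Fin k → ℤ × ℤ) (B : ℕ) (R : ℝ) :
    admBox L B R = admBoxN L B (primorial ⌊R⌋₊) := rfl

/-- Membership in `admBoxN` (`N ≠ 0`). [cite: Maynard2016DenseClusters, proof of Lemma 9.3 p. 24, (9.27)] -/
theorem mem_admBoxN_iff {L : Fin k → ℤ × ℤ} {B N : ℕ} (hN : N ≠ 0) {d : Fin k → ℕ} :
    d ∈ admBoxN L B N ↔ (∀ i, d i ∣ N) ∧ Squarefree (∏ i, d i) ∧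
      (∏ i, d i).Coprime (wCut k B * B) ∧
      ∀ j : Fin k, ∀ p ∈ (d j).primeFactors, ∃ n ∈ Finset.range p, (p : ℤ) ∣ formEval (L j) n ∧
        ∀ j' : Fin k, j' < j → ¬ (p : ℤ) ∣ formEval (L j') n := by
  classical
  unfold admBoxN
  rw [Finset.mem_filter, Fintype.mem_piFinset]
  simp only [Nat.mem_divisors, hN, ne_eq, not_false_eq_true, and_true]

/-- Membership in `admBox`. [cite: Maynard2016DenseClusters, proof of Lemma 9.3 p. 24, (9.27)] -/
theorem mem_admBox_iff {L : Fin k → ℤ × ℤ} {B : ℕ} {R : ℝ} {d : Fin k → ℕ} :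
    d ∈ admBox L B R ↔ (∀ i, d i ∣ primorial ⌊R⌋₊) ∧ Squarefree (∏ i, d i) ∧
      (∏ i, d i).Coprime (wCut k B * B) ∧
      ∀ j : Fin k, ∀ p ∈ (d j).primeFactors, ∃ n ∈ Finset.range p, (p : ℤ) ∣ formEval (L j) n ∧
        ∀ j' : Fin k, j' < j → ¬ (p : ℤ) ∣ formEval (L j') n :=
  mem_admBoxN_iff (primorial_ne_zero _)

/-- `e ∈ admBoxN N` (`N ≠ 0`) `⇒ 1 ≤ eᵢ`. [cite: Maynard2016DenseClusters, proof of Lemma 9.3 p. 24] -/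
theorem one_le_of_mem_admBoxN {L : Fin k → ℤ × ℤ} {B N : ℕ} (hN : N ≠ 0) {e : Fin k → ℕ}
    (he : e ∈ admBoxN L B N) (i : Fin k) : 1 ≤ e i :=
  Nat.pos_of_ne_zero fun h0 => hN (zero_dvd_iff.1 (h0 ▸ ((mem_admBoxN_iff hN).1 he).1 i))

/-- The primes of `e_j` (`e ∈ admBoxN N`) divide `N` and are admissible at index `j`.
[cite: Maynard2016DenseClusters, §7 p. 13 (the restriction `(d_j, W_j) = 1`), proof of Lemma 9.3 p. 24] -/
theorem dvd_and_mem_admIdx_of_mem_admBoxN {L : Fin k → ℤ × ℤ} {B N : ℕ} (hN : N ≠ 0)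
    {e : Fin k → ℕ} (he : e ∈ admBoxN L B N) {j : Fin k} {p : ℕ} (hp : p ∈ (e j).primeFactors) :
    p ∣ N ∧ j ∈ admIdx L p :=
  ⟨(Nat.dvd_of_mem_primeFactors hp).trans (((mem_admBoxN_iff hN).1 he).1 j),
    mem_admIdx.2 (((mem_admBoxN_iff hN).1 he).2.2.2 j p hp)⟩

/-- `admBoxN N` is closed under coordinatewise divisors. [cite: Maynard2016DenseClusters, proof of Lemma 9.3 p. 24] -/
theorem mem_admBoxN_of_dvd {L : Fin k → ℤ × ℤ} {B N : ℕ} (hN : N ≠ 0) {e d : Fin k → ℕ}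
    (he : e ∈ admBoxN L B N) (hd : ∀ i, d i ∣ e i) : d ∈ admBoxN L B N := by
  obtain ⟨hdiv, hsq, hcop, hidx⟩ := (mem_admBoxN_iff hN).1 he
  have he1 : ∀ i, 1 ≤ e i := one_le_of_mem_admBoxN hN he
  have hprod : (∏ i, d i) ∣ ∏ i, e i := Finset.prod_dvd_prod_of_dvd _ _ fun i _ => hd i
  refine (mem_admBoxN_iff hN).2 ⟨fun i => (hd i).trans (hdiv i), hsq.squarefree_of_dvd hprod,
    Nat.Coprime.coprime_dvd_left hprod hcop, fun j p hp => ?_⟩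
  exact hidx j p (Nat.mem_primeFactors.2 ⟨Nat.prime_of_mem_primeFactors hp,
    (Nat.dvd_of_mem_primeFactors hp).trans (hd j), Nat.one_le_iff_ne_zero.1 (he1 j)⟩)

/-- Removing a prime from one coordinate stays in `admBoxN N`.
[cite: Maynard2016DenseClusters, proof of Lemma 9.3 p. 24, (9.27)] -/
theorem update_div_mem_admBoxN {L : Fin k → ℤ × ℤ} {B N : ℕ} (hN : N ≠ 0) {e : Fin k → ℕ}
    (he : e ∈ admBoxN L B N) (j : Fin k) {p : ℕ} (hpj : p ∣ e j) :
    Function.update e j (e j / p) ∈ admBoxN L B N := by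
  refine mem_admBoxN_of_dvd hN he fun i => ?_
  by_cases hi : i = j
  · subst hi; rw [Function.update_self]; exact Nat.div_dvd_of_dvd hpj
  · rw [Function.update_of_ne hi]

/-- **Inserting a prime**: for `e ∈ admBoxN N`, a prime `p ∣ N` with `p ∤ ∏ eᵢ`, `(p, WB) = 1`, and an index
`j` admissible for `p`, the vector `e·p@j` lies in `admBoxN N` (no size condition — contrast
`update_mul_mem_dkBox`). [cite: Maynard2016DenseClusters, proof of Lemma 9.3 p. 24, (9.27) («components which can be a multiple of p»)] -/
theorem update_mul_mem_admBoxN {L : Fin k → ℤ × ℤ} {B N : ℕ} (hN : N ≠ 0) {e : Fin k → ℕ}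
    (he : e ∈ admBoxN L B N) {p : ℕ} (hp : p.Prime) (hpN : p ∣ N) {j : Fin k}
    (hj : j ∈ admIdx L p) (hpe : ¬ p ∣ ∏ i, e i) (hpW : p.Coprime (wCut k B * B)) :
    Function.update e j (e j * p) ∈ admBoxN L B N := by
  classical
  obtain ⟨hdiv, hsq, hcop, hidx⟩ := (mem_admBoxN_iff hN).1 he
  have he1 : ∀ i, 1 ≤ e i := one_le_of_mem_admBoxN hN he
  refine (mem_admBoxN_iff hN).2 ⟨fun i => ?_, ?_, ?_, fun i q hq => ?_⟩
  · by_cases hi : i = j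
    · subst hi
      rw [Function.update_self]
      have hpi : ¬ p ∣ e i := fun h => hpe (h.trans (Finset.dvd_prod_of_mem _ (Finset.mem_univ i)))
      have hcp : (e i).Coprime p := Nat.coprime_comm.1 ((Nat.Prime.coprime_iff_not_dvd hp).2 hpi)
      exact hcp.mul_dvd_of_dvd_of_dvd (hdiv i) hpN
    · rw [Function.update_of_ne hi]; exact hdiv i
  · rw [prod_update_mul]
    exact Nat.squarefree_mul_iff.2
      ⟨(Nat.Prime.coprime_iff_not_dvd hp).2 hpe, (Nat.prime_iff.1 hp).squarefree, hsq⟩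
  · rw [prod_update_mul]; exact Nat.coprime_mul_iff_left.2 ⟨hpW, hcop⟩
  · by_cases hi : i = j
    · subst hi
      rw [Function.update_self, Nat.primeFactors_mul (Nat.one_le_iff_ne_zero.1 (he1 i)) hp.ne_zero,
        Finset.mem_union, hp.primeFactors, Finset.mem_singleton] at hq
      rcases hq with hq | rfl
      · exact hidx i q hq
      · exact mem_admIdx.1 hj
    · rw [Function.update_of_ne hi] at hq; exact hidx i q hq

/-- With one prime more in the modulus (`p ∤ N`): `e ∈ admBoxN (N·p)` iff either `p ∤ ∏ eᵢ` and
`e ∈ admBoxN N`, or `p ∣ e_j` for a (necessarily unique) `j` and `e/p@j ∈ admBoxN N` — the case split of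
the Euler-product induction. Stated as the two implications used.
[cite: Maynard2016DenseClusters, proof of Lemma 9.3 p. 24, (9.27) («by multiplicativity»)] -/
theorem mem_admBoxN_of_mem_mul_of_not_dvd {L : Fin k → ℤ × ℤ} {B N : ℕ} (hN : N ≠ 0) {p : ℕ}
    (hp : p.Prime) {e : Fin k → ℕ} (he : e ∈ admBoxN L B (N * p)) (hpe : ¬ p ∣ ∏ i, e i) :
    e ∈ admBoxN L B N := by
  have hNp : N * p ≠ 0 := Nat.mul_ne_zero hN hp.ne_zero
  obtain ⟨hdiv, hsq, hcop, hidx⟩ := (mem_admBoxN_iff hNp).1 he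
  refine (mem_admBoxN_iff hN).2 ⟨fun i => ?_, hsq, hcop, hidx⟩
  have hpi : ¬ p ∣ e i := fun h => hpe (h.trans (Finset.dvd_prod_of_mem _ (Finset.mem_univ i)))
  exact ((Nat.Prime.coprime_iff_not_dvd hp).2 hpi).symm.dvd_of_dvd_mul_right (hdiv i)

/-- `admBoxN N ⊆ admBoxN (N·p)`. [cite: Maynard2016DenseClusters, proof of Lemma 9.3 p. 24, (9.27)] -/
theorem admBoxN_subset_mul {L : Fin k → ℤ × ℤ} {B N : ℕ} (hN : N ≠ 0) {p : ℕ} (hp : p ≠ 0) :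
    admBoxN L B N ⊆ admBoxN L B (N * p) := by
  intro e he
  obtain ⟨hdiv, hsq, hcop, hidx⟩ := (mem_admBoxN_iff hN).1 he
  exact (mem_admBoxN_iff (Nat.mul_ne_zero hN hp)).2 ⟨fun i => (hdiv i).mul_right p, hsq, hcop, hidx⟩

/-- `e ∈ admBox ⇒ 1 ≤ eᵢ`. [cite: Maynard2016DenseClusters, proof of Lemma 9.3 p. 24] -/
theorem one_le_of_mem_admBox {L : Fin k → ℤ × ℤ} {B : ℕ} {R : ℝ} {e : Fin k → ℕ}
    (he : e ∈ admBox L B R) (i : Fin k) : 1 ≤ e i :=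
  Nat.pos_of_ne_zero fun h0 => primorial_ne_zero _ (zero_dvd_iff.1 (h0 ▸ (mem_admBox_iff.1 he).1 i))

/-- `e ∈ admBox ⇒ ∏ eᵢ` square-free. [cite: Maynard2016DenseClusters, proof of Lemma 9.3 p. 24] -/
theorem squarefree_of_mem_admBox {L : Fin k → ℤ × ℤ} {B : ℕ} {R : ℝ} {e : Fin k → ℕ}
    (he : e ∈ admBox L B R) : Squarefree (∏ i, e i) :=
  (mem_admBox_iff.1 he).2.1

/-- `e ∈ admBox ⇒ (∏ eᵢ, WB) = 1`. [cite: Maynard2016DenseClusters, proof of Lemma 9.3 p. 24] -/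
theorem coprime_of_mem_admBox {L : Fin k → ℤ × ℤ} {B : ℕ} {R : ℝ} {e : Fin k → ℕ}
    (he : e ∈ admBox L B R) : (∏ i, e i).Coprime (wCut k B * B) :=
  (mem_admBox_iff.1 he).2.2.1

/-- The primes of `e ∈ admBox` are `≤ ⌊R⌋`. [cite: Maynard2016DenseClusters, proof of Lemma 9.3 p. 24] -/
theorem le_floor_of_mem_primeFactors_of_mem_admBox {L : Fin k → ℤ × ℤ} {B : ℕ} {R : ℝ}
    {e : Fin k → ℕ} (he : e ∈ admBox L B R) {j : Fin k} {p : ℕ} (hp : p ∈ (e j).primeFactors) :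
    p ≤ ⌊R⌋₊ :=
  (Nat.prime_of_mem_primeFactors hp).dvd_primorial_iff.1
    ((Nat.dvd_of_mem_primeFactors hp).trans ((mem_admBox_iff.1 he).1 j))

/-- The primes of `e_j` (`e ∈ admBox`) are admissible at index `j`.
[cite: Maynard2016DenseClusters, §7 p. 13 (the restriction `(d_j, W_j) = 1`)] -/
theorem mem_admIdx_of_mem_admBox {L : Fin k → ℤ × ℤ} {B : ℕ} {R : ℝ} {e : Fin k → ℕ}
    (he : e ∈ admBox L B R) {j : Fin k} {p : ℕ} (hp : p ∈ (e j).primeFactors) : j ∈ admIdx L p :=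
  mem_admIdx.2 ((mem_admBox_iff.1 he).2.2.2 j p hp)

/-- `𝒟_k(𝓛) ⊆ admBox`. [cite: Maynard2016DenseClusters, proof of Lemma 9.3 p. 24] -/
theorem dkBox_subset_admBox (L : Fin k → ℤ × ℤ) (B : ℕ) (R : ℝ) : dkBox L B R ⊆ admBox L B R := by
  intro e he
  obtain ⟨hbox, hsq, hcop, hidx⟩ := mem_dkBox_iff.1 he
  refine mem_admBox_iff.2 ⟨fun i => ?_, hsq, hcop, hidx⟩
  have hsqi : Squarefree (e i) :=
    hsq.squarefree_of_dvd (Finset.dvd_prod_of_mem _ (Finset.mem_univ i))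
  exact hsqi.dvd_primorial.trans (primorial_dvd_primorial (Finset.mem_Icc.1 (hbox i)).2)

/-- An element of `admBox` with all coordinates `≤ ⌊R⌋` lies in `𝒟_k(𝓛)`.
[cite: FordGreenKonyaginMaynardTao2018, (7.5) p. 21] -/
theorem mem_dkBox_of_mem_admBox {L : Fin k → ℤ × ℤ} {B : ℕ} {R : ℝ} {e : Fin k → ℕ}
    (he : e ∈ admBox L B R) (hle : ∀ i, e i ≤ ⌊R⌋₊) : e ∈ dkBox L B R := by
  obtain ⟨-, hsq, hcop, hidx⟩ := mem_admBox_iff.1 he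
  exact mem_dkBox_iff.2 ⟨fun i => Finset.mem_Icc.2 ⟨one_le_of_mem_admBox he i, hle i⟩, hsq, hcop, hidx⟩

/-- `𝒟_k(𝓛) = admBox ∩ {∀ i, eᵢ ≤ ⌊R⌋}`. [cite: FordGreenKonyaginMaynardTao2018, (7.5) p. 21] -/
theorem dkBox_eq_filter_admBox (L : Fin k → ℤ × ℤ) (B : ℕ) (R : ℝ) :
    dkBox L B R = (admBox L B R).filter fun e => ∀ i, e i ≤ ⌊R⌋₊ := by
  ext e
  rw [Finset.mem_filter]
  constructor
  · intro he
    exact ⟨dkBox_subset_admBox L B R he, fun i => (Finset.mem_Icc.1 ((mem_dkBox_iff.1 he).1 i)).2⟩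
  · rintro ⟨he, hle⟩
    exact mem_dkBox_of_mem_admBox he hle

/-- The vectors of `admBox ∖ 𝒟_k(𝓛)` have `∏ eᵢ > ⌊R⌋`.
[cite: Maynard2016DenseClusters, proof of Lemma 9.3 p. 24 (y supported on ∏ ≤ R)] -/
theorem floor_lt_prod_of_mem_admBox_of_not_mem {L : Fin k → ℤ × ℤ} {B : ℕ} {R : ℝ}
    {e : Fin k → ℕ} (he : e ∈ admBox L B R) (hn : e ∉ dkBox L B R) : ⌊R⌋₊ < ∏ i, e i := by
  by_contra hle
  refine hn (mem_dkBox_of_mem_admBox he fun i => ?_)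
  refine le_trans ?_ (not_lt.1 hle)
  exact Finset.single_le_prod' (fun j _ => one_le_of_mem_admBox he j) (Finset.mem_univ i)

/-- `y_e = 0` on `admBox ∖ 𝒟_k(𝓛)` (`R > 1`). [cite: Maynard2016DenseClusters, (8.6) p. 14, proof of Lemma 9.3 p. 24] -/
theorem yVar_eq_zero_of_mem_admBox_of_not_mem {L : Fin k → ℤ × ℤ} {B : ℕ} {R : ℝ} (hR : 1 < R)
    (F : (Fin k → ℝ) → ℝ) {e : Fin k → ℕ} (he : e ∈ admBox L B R) (hn : e ∉ dkBox L B R) :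
    yVar L B R F e = 0 :=
  yVar_eq_zero_of_floor_lt hR (one_le_of_mem_admBox he) (floor_lt_prod_of_mem_admBox_of_not_mem he hn)

/-- **Sums over `𝒟_k(𝓛)` = sums over `admBox`** for summands vanishing when `∏ eᵢ > ⌊R⌋`
(any side condition `P`). [cite: Maynard2016DenseClusters, proof of Lemma 9.3 p. 24, (9.26)–(9.27)] -/
theorem sum_filter_admBox_eq_sum_filter_dkBox {L : Fin k → ℤ × ℤ} {B : ℕ} {R : ℝ}
    (P : (Fin k → ℕ) → Prop) [DecidablePred P] (G : (Fin k → ℕ) → ℝ)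
    (hG : ∀ e ∈ admBox L B R, ⌊R⌋₊ < ∏ i, e i → G e = 0) :
    ∑ e ∈ (admBox L B R).filter P, G e = ∑ e ∈ (dkBox L B R).filter P, G e := by
  symm
  refine Finset.sum_subset (Finset.filter_subset_filter P (dkBox_subset_admBox L B R)) ?_
  intro e he hne
  obtain ⟨hea, hP⟩ := Finset.mem_filter.1 he
  have hnd : e ∉ dkBox L B R := fun h => hne (Finset.mem_filter.2 ⟨h, hP⟩)
  exact hG e hea (floor_lt_prod_of_mem_admBox_of_not_mem hea hnd)

/-- **Display (9.25) over the size-free box**: for `r ∈ 𝒟'ₖ⁽ᵐ⁾` (`R > 1`),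
`y^{(m)}_r = (∏ rᵢ/φ_L(∏ rᵢ)) ∑_{e ∈ admBox, rᵢ ∣ eᵢ} y_e σ(r,e)/φ_ω(∏ eᵢ/rᵢ)`.
[cite: Maynard2016DenseClusters, proof of Lemma 9.3 pp. 23–24, (9.25)–(9.27)] -/
theorem yVarM_eq_sum_admBox {L : Fin k → ℤ × ℤ} (hadm : FormsAdmissible L) {B : ℕ} {R : ℝ}
    (hR : 1 < R) (F : (Fin k → ℝ) → ℝ) {m : Fin k} {r : Fin k → ℕ} (hr : r ∈ dkBoxP L B R m) :
    yVarM L B R F m r =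
      (∏ i, r i : ℕ) / totForm (L m) (∏ i, r i) *
        ∑ e ∈ (admBox L B R).filter (fun e => ∀ i, r i ∣ e i),
          yVar L B R F e * sPrimeProdM L m r e / phiOmega L (∏ i, e i / r i) := by
  classical
  rw [yVarM_eq_sum_yVar_quot hadm F hr,
    sum_filter_admBox_eq_sum_filter_dkBox (fun e => ∀ i, r i ∣ e i) _ fun e he hlt => ?_]
  rw [yVar_eq_zero_of_floor_lt hR (one_le_of_mem_admBox he) hlt, zero_mul, zero_div]

/-! ### Local structure of `admBox` (the primorial instance) -/

/-- `admBox` is closed under coordinatewise divisors. [cite: Maynard2016DenseClusters, proof of Lemma 9.3 p. 24] -/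
theorem mem_admBox_of_dvd {L : Fin k → ℤ × ℤ} {B : ℕ} {R : ℝ} {e d : Fin k → ℕ}
    (he : e ∈ admBox L B R) (hd : ∀ i, d i ∣ e i) : d ∈ admBox L B R :=
  mem_admBoxN_of_dvd (primorial_ne_zero _) he hd

/-- Removing a prime from one coordinate stays in `admBox`.
[cite: Maynard2016DenseClusters, proof of Lemma 9.3 p. 24, (9.27)] -/
theorem update_div_mem_admBox {L : Fin k → ℤ × ℤ} {B : ℕ} {R : ℝ} {e : Fin k → ℕ}
    (he : e ∈ admBox L B R) (j : Fin k) {p : ℕ} (hpj : p ∣ e j) :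
    Function.update e j (e j / p) ∈ admBox L B R :=
  update_div_mem_admBoxN (primorial_ne_zero _) he j hpj

/-- **Inserting a prime** `p ≤ ⌊R⌋`, `p ∤ WB·∏ eᵢ`, at an admissible index keeps `e` in `admBox`.
[cite: Maynard2016DenseClusters, proof of Lemma 9.3 p. 24, (9.27)] -/
theorem update_mul_mem_admBox {L : Fin k → ℤ × ℤ} {B : ℕ} {R : ℝ} {e : Fin k → ℕ}
    (he : e ∈ admBox L B R) {p : ℕ} (hp : p.Prime) (hpR : p ≤ ⌊R⌋₊) {j : Fin k}
    (hj : j ∈ admIdx L p) (hpe : ¬ p ∣ ∏ i, e i) (hpW : p.Coprime (wCut k B * B)) :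
    Function.update e j (e j * p) ∈ admBox L B R :=
  update_mul_mem_admBoxN (primorial_ne_zero _) he hp (hp.dvd_primorial_iff.2 hpR) hj hpe hpW

/-- Every `r ∈ 𝒟'ₖ⁽ᵐ⁾` with its `m`-th coordinate replaced by an admissible `e_m` (`e_m ∣ ⌊R⌋#`,
coprime to `WB·∏ rᵢ`, primes admissible at `m`) lies in `admBox`: the vector `r'` of display (9.26).
[cite: Maynard2016DenseClusters, proof of Lemma 9.3 p. 23, (9.26) (definition of r')] -/
theorem update_mem_admBox {L : Fin k → ℤ × ℤ} {B : ℕ} {R : ℝ} {m : Fin k} {r : Fin k → ℕ}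
    (hr : r ∈ dkBoxP L B R m) {c : ℕ} (hc : c ∣ primorial ⌊R⌋₊) (hcr : c.Coprime (∏ i, r i))
    (hcW : c.Coprime (wCut k B * B))
    (hidx : ∀ p ∈ c.primeFactors, ∃ n ∈ Finset.range p, (p : ℤ) ∣ formEval (L m) n ∧
      ∀ j' : Fin k, j' < m → ¬ (p : ℤ) ∣ formEval (L j') n) :
    Function.update r m c ∈ admBox L B R := by
  classical
  have hrbox : r ∈ dkBox L B R := dkBoxP_subset L B R m hr
  have hrm : r m = 1 := ((mem_dkBoxP_iff).1 hr).2.1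
  obtain ⟨hdiv, hsq, hcop, hidxr⟩ := mem_admBox_iff.1 (dkBox_subset_admBox L B R hrbox)
  have hprod : ∏ i, Function.update r m c i = c * ∏ i, r i := by
    have h := prod_update_mul r m c
    rwa [hrm, one_mul] at h
  refine mem_admBox_iff.2 ⟨fun i => ?_, ?_, ?_, fun i q hq => ?_⟩
  · by_cases hi : i = m
    · subst hi; rw [Function.update_self]; exact hc
    · rw [Function.update_of_ne hi]; exact hdiv i
  · rw [hprod]
    exact Nat.squarefree_mul_iff.2 ⟨hcr, (squarefree_primorial _).squarefree_of_dvd hc, hsq⟩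
  · rw [hprod]; exact Nat.coprime_mul_iff_left.2 ⟨hcW, hcop⟩
  · by_cases hi : i = m
    · subst hi
      rw [Function.update_self] at hq
      exact hidx q hq
    · rw [Function.update_of_ne hi] at hq; exact hidxr i q hq

/-! ### The Euler-product step in the modulus (display (9.27), «by multiplicativity»)

For the evaluation of the `(s,t)`-sum one sums a weight `w`, multiplicative under inserting a new prime at one
coordinate, over the vectors `q ∈ admBoxN L B N` with `q_m = 1` and `∏ qᵢ` coprime to a fixed `M` (in the
application `M = ∏ r'ᵢ`); adding one prime `p ∤ N` to the modulus multiplies the sum by the local factor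
`1 + ∑_{j ∈ admIdx(p), j ≠ m} w_p(j)` if `p ∤ WB·M`, and by `1` otherwise. -/

/-- The summation range of the `(s,t)`-sum for the modulus `N`: `q ∈ admBoxN L B N` with `q_m = 1` and
`(∏ qᵢ, M) = 1`. [cite: Maynard2016DenseClusters, proof of Lemma 9.3 p. 24, (9.27) (the starred conditions)] -/
def qBox (L : Fin k → ℤ × ℤ) (B N : ℕ) (m : Fin k) (M : ℕ) : Finset (Fin k → ℕ) :=
  (admBoxN L B N).filter fun q => q m = 1 ∧ Nat.Coprime (∏ i, q i) M

/-- Membership in `qBox`. [cite: Maynard2016DenseClusters, proof of Lemma 9.3 p. 24, (9.27)] -/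
theorem mem_qBox_iff {L : Fin k → ℤ × ℤ} {B N : ℕ} {m : Fin k} {M : ℕ} {q : Fin k → ℕ} :
    q ∈ qBox L B N m M ↔ q ∈ admBoxN L B N ∧ q m = 1 ∧ Nat.Coprime (∏ i, q i) M := by
  unfold qBox; rw [Finset.mem_filter]

/-- For `q ∈ admBoxN N` and a prime `p ∤ N`: `p ∤ ∏ qᵢ`. [cite: Maynard2016DenseClusters, proof of Lemma 9.3 p. 24] -/
theorem not_dvd_prod_of_mem_admBoxN {L : Fin k → ℤ × ℤ} {B N : ℕ} (hN : N ≠ 0) {p : ℕ} (hp : p.Prime)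
    (hpN : ¬ p ∣ N) {q : Fin k → ℕ} (hq : q ∈ admBoxN L B N) : ¬ p ∣ ∏ i, q i := by
  intro hdvd
  obtain ⟨i, -, hi⟩ := (Prime.dvd_finsetProd_iff hp.prime _).1 hdvd
  exact hpN (hi.trans (((mem_admBoxN_iff hN).1 hq).1 i))

/-- **The Euler-product step**: for `N ≠ 0`, a prime `p ∤ N`, and a weight `w` with
`w(q·p@j) = w(q)·w_p(j)` on `qBox N`,
`∑_{q ∈ qBox(N·p)} w(q) = (∑_{q ∈ qBox(N)} w(q)) · (1 + [p ∤ WB·M] ∑_{j ∈ admIdx(p) ∖ {m}} w_p(j))`.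
[cite: Maynard2016DenseClusters, proof of Lemma 9.3 p. 24, (9.27) («we can evaluate it by counting how many pairs s, t correspond to a given choice of s, t»)] -/
theorem sum_qBox_mul_prime {L : Fin k → ℤ × ℤ} {B N : ℕ} (hN : N ≠ 0) {p : ℕ} (hp : p.Prime)
    (hpN : ¬ p ∣ N) (m : Fin k) (M : ℕ) (w : (Fin k → ℕ) → ℝ) (wloc : Fin k → ℝ)
    (hw : ∀ q ∈ qBox L B N m M, ∀ j, w (Function.update q j (q j * p)) = w q * wloc j) :
    ∑ q ∈ qBox L B (N * p) m M, w q =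
      (∑ q ∈ qBox L B N m M, w q) *
        (1 + if p.Coprime (wCut k B * B) ∧ ¬ p ∣ M then ∑ j ∈ (admIdx L p).erase m, wloc j else 0) := by
  classical
  have hNp : N * p ≠ 0 := Nat.mul_ne_zero hN hp.ne_zero
  set S := ∑ q ∈ qBox L B N m M, w q with hS
  -- (A) the part `p ∤ ∏ q` is the sum over `qBox N`
  have hA : (qBox L B (N * p) m M).filter (fun q => ¬ p ∣ ∏ i, q i) = qBox L B N m M := by
    ext q
    simp only [Finset.mem_filter, mem_qBox_iff]
    constructor
    · rintro ⟨⟨hq, hm, hM⟩, hnd⟩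
      exact ⟨mem_admBoxN_of_mem_mul_of_not_dvd hN hp hq hnd, hm, hM⟩
    · rintro ⟨hq, hm, hM⟩
      exact ⟨⟨admBoxN_subset_mul hN hp.ne_zero hq, hm, hM⟩, not_dvd_prod_of_mem_admBoxN hN hp hpN hq⟩
  -- (B) the part `p ∣ ∏ q` splits according to the unique coordinate divisible by `p`
  have hB : ∑ q ∈ (qBox L B (N * p) m M).filter (fun q => p ∣ ∏ i, q i), w q =
      ∑ j, ∑ q ∈ (qBox L B (N * p) m M).filter (fun q => p ∣ q j), w q := by
    have hset : (qBox L B (N * p) m M).filter (fun q => p ∣ ∏ i, q i) =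
        (Finset.univ : Finset (Fin k)).biUnion
          fun j => (qBox L B (N * p) m M).filter (fun q => p ∣ q j) := by
      ext q
      simp only [Finset.mem_filter, Finset.mem_biUnion, Finset.mem_univ, true_and]
      constructor
      · rintro ⟨hq, hdvd⟩
        obtain ⟨j, -, hj⟩ := (Prime.dvd_finsetProd_iff hp.prime _).1 hdvd
        exact ⟨j, hq, hj⟩
      · rintro ⟨j, hq, hj⟩
        exact ⟨hq, hj.trans (Finset.dvd_prod_of_mem _ (Finset.mem_univ j))⟩
    rw [hset, Finset.sum_biUnion]
    intro j _ j' _ hjj'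
    simp only [Function.onFun]
    rw [Finset.disjoint_left]
    intro q hqj hqj'
    obtain ⟨hq, hpj⟩ := Finset.mem_filter.1 hqj
    obtain ⟨-, hpj'⟩ := Finset.mem_filter.1 hqj'
    have hsq : Squarefree (∏ i, q i) := ((mem_admBoxN_iff hNp).1 (mem_qBox_iff.1 hq).1).2.1
    have hcop := coprime_apply_of_squarefree_prod hsq hjj'
    have hone : p ∣ 1 := by
      have := Nat.dvd_gcd hpj hpj'
      rwa [hcop] at this
    exact hp.one_lt.ne' (Nat.dvd_one.1 hone)
  -- (C) the fibre over a coordinate `j`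
  have hC : ∀ j : Fin k, ∑ q ∈ (qBox L B (N * p) m M).filter (fun q => p ∣ q j), w q =
      if j ≠ m ∧ j ∈ admIdx L p ∧ p.Coprime (wCut k B * B) ∧ ¬ p ∣ M then wloc j * S else 0 := by
    intro j
    split_ifs with hcond
    · obtain ⟨hjm, hj, hpW, hpM⟩ := hcond
      rw [hS, Finset.mul_sum]
      symm
      refine Finset.sum_bij' (fun q _ => Function.update q j (q j * p))
        (fun q _ => Function.update q j (q j / p)) ?_ ?_ ?_ ?_ ?_
      · intro q hq
        obtain ⟨hqN, hqm, hqM⟩ := mem_qBox_iff.1 hq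
        have hnd : ¬ p ∣ ∏ i, q i := not_dvd_prod_of_mem_admBoxN hN hp hpN hqN
        refine Finset.mem_filter.2 ⟨mem_qBox_iff.2 ⟨?_, ?_, ?_⟩, ?_⟩
        · exact update_mul_mem_admBoxN hNp (admBoxN_subset_mul hN hp.ne_zero hqN) hp
            (Dvd.intro_left _ rfl) hj hnd hpW
        · rw [Function.update_of_ne (Ne.symm hjm)]; exact hqm
        · rw [prod_update_mul]
          exact Nat.Coprime.mul_left ((Nat.Prime.coprime_iff_not_dvd hp).2 hpM) hqM
        · rw [Function.update_self]; exact Dvd.intro_left _ rfl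
      · intro q hq
        obtain ⟨hq', hpj⟩ := Finset.mem_filter.1 hq
        obtain ⟨hqNp, hqm, hqM⟩ := mem_qBox_iff.1 hq'
        have hsq : Squarefree (∏ i, q i) := ((mem_admBoxN_iff hNp).1 hqNp).2.1
        have hprod : p * ∏ i, Function.update q j (q j / p) i = ∏ i, q i := mul_prod_update_div q j hpj
        have hnd : ¬ p ∣ ∏ i, Function.update q j (q j / p) i := by
          rw [← hprod] at hsq
          exact (Nat.Prime.coprime_iff_not_dvd hp).1 (Nat.squarefree_mul_iff.1 hsq).1
        refine mem_qBox_iff.2 ⟨?_, ?_, ?_⟩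
        · exact mem_admBoxN_of_mem_mul_of_not_dvd hN hp (update_div_mem_admBoxN hNp hqNp j hpj) hnd
        · rw [Function.update_of_ne (Ne.symm hjm)]; exact hqm
        · exact Nat.Coprime.coprime_dvd_left (Dvd.intro_left _ hprod) hqM
      · intro q hq
        simp only [Function.update_idem, Function.update_self, Nat.mul_div_cancel _ hp.pos,
          Function.update_eq_self]
      · intro q hq
        obtain ⟨-, hpj⟩ := Finset.mem_filter.1 hq
        simp only [Function.update_idem, Function.update_self, Nat.div_mul_cancel hpj,
          Function.update_eq_self]
      · intro q hq
        rw [hw q hq j, mul_comm]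
    · refine Finset.sum_eq_zero fun q hq => ?_
      exfalso
      obtain ⟨hq', hpj⟩ := Finset.mem_filter.1 hq
      obtain ⟨hqNp, hqm, hqM⟩ := mem_qBox_iff.1 hq'
      have hq1 : 1 ≤ q j := one_le_of_mem_admBoxN hNp hqNp j
      have hpf : p ∈ (q j).primeFactors := Nat.mem_primeFactors.2 ⟨hp, hpj, Nat.one_le_iff_ne_zero.1 hq1⟩
      have hpP : p ∣ ∏ i, q i := hpj.trans (Finset.dvd_prod_of_mem _ (Finset.mem_univ j))
      refine hcond ⟨?_, (dvd_and_mem_admIdx_of_mem_admBoxN hNp hqNp hpf).2, ?_, ?_⟩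
      · rintro rfl
        rw [hqm] at hpj
        exact hp.one_lt.ne' (Nat.dvd_one.1 hpj)
      · exact Nat.Coprime.coprime_dvd_left hpP ((mem_admBoxN_iff hNp).1 hqNp).2.2.1
      · exact fun hpM => (Nat.Prime.coprime_iff_not_dvd hp).1
          (Nat.Coprime.coprime_dvd_left hpP hqM) hpM
  -- assemble
  rw [← Finset.sum_filter_add_sum_filter_not (qBox L B (N * p) m M) (fun q => p ∣ ∏ i, q i), hB, hA,
    Finset.sum_congr rfl fun j _ => hC j]
  rw [mul_add, mul_one, add_comm]
  congr 1
  split_ifs with hc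
  · rw [Finset.mul_sum, ← Finset.sum_filter]
    refine Finset.sum_congr (Finset.ext fun j => ?_) fun j _ => mul_comm _ _
    simp only [Finset.mem_filter, Finset.mem_univ, true_and, Finset.mem_erase, hc.2,
      not_false_eq_true, and_true]
    exact ⟨fun h => ⟨h.1, h.2.1⟩, fun h => ⟨h.1, h.2, hc.1⟩⟩
  · rw [mul_zero]
    refine Finset.sum_eq_zero fun j _ => ?_
    rw [if_neg fun h => hc ⟨h.2.2.1, h.2.2.2⟩]

end FGKMT2018

end Literature.NumberTheory.Sieve
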